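import Literature.AlgebraicGeometry.Motives.MiddleConvolutionLocalData
import Literature.AlgebraicGeometry.Motives.RigidTuplesProofs
import HarnessLib

/-!
# Katz's existence algorithm for rigid tuples ([DettweilerReiter2000, Thm. 4.9]) — proofs

This file proves, in the tuple model of `Literature.AlgebraicGeometry.Motives.RigidTuples`, the
result behind the named fact `DettweilerReiter2000_thm_4_9` (= Katz's existence algorithm
[Katz1996, §5.2, Lemma 6.3.7]) for tuples of **index of rigidity `2`**:

* `RigidTuple.reducesToRankOne_of_rigidityIndex_eq_two`: over an algebraically closed field `K`,
  an irreducible tuple `T = (T_i)_{i < r}` in `GL(V)`, `V` finite-dimensional, with `T_∞ = 1` and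
  index of rigidity `2` is connected to a rank-one tuple by multiplications `M_Λ` and middle
  convolutions `MC_λ`, `λ ≠ 1` (`RigidTuple.ReducesToRankOne`) — unconditionally; this makes the
  tree's corollaries `DettweilerReiter2000_thm_4_9.of_rigidityIndex_eq_two` /
  `….of_rigidityIndex_eq_two'` free of their named-fact hypotheses.
* `DettweilerReiter2000_thm_4_9_of_lemma_4_7`: the named fact `DettweilerReiter2000_thm_4_9`
  (hypothesis: *linearly* rigid) follows from the named fact `DettweilerReiter2000_lemma_4_7`
  (linearly rigid ⟺ index `2`, [Katz1996, Thm. 1.1.2]) — this is the first sentence of the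
  printed proof; by the tree's `DettweilerReiter2000_lemma_4_7_iff_two_le` (`RigidTuplesProofs.lean`,
  where "index `2` ⟹ linearly rigid" and "index `≤ 2`" are proved) only the inequality
  "linearly rigid ⟹ index `≥ 2`" ([Katz1996, Thm. 1.1.2 (1)], a dimension count on moduli of
  tuples, not in [DettweilerReiter2000]) remains: `DettweilerReiter2000_thm_4_9_of_two_le`.  That
  inequality is the only ingredient of Thm. 4.9 not formalised.

## The proof ([DettweilerReiter2000, p. 771], followed step by step)

"We show that for any linearly rigid and irreducible tuple `T = (T_r, …, T_1)`, `T_∞ = 1`, in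
`GL_n(K)`, `n ≥ 2`, there are `λ_i ∈ Kˣ` such that `Σ rk(λ_i T_i − 1) < 2n`": this is
`RigidTuple.exists_scalars_sum_rank_lt`, from `Σ dim C(T_i) = (r − 2)n² + 2` (index `2`) and the
bound `dim C(T_i) ≤ n · (n − n_i)` (`RigidTuple.exists_finrank_centralizer_le_mul`, proved in
`MiddleConvolutionLocalData.lean` by the peeling lemma instead of Jordan forms).  "By Scott's lemma
(Lemma 4.5) we know `λ := λ_1 ⋯ λ_r ≠ 1`": the tree's `RigidTuple.scott_two_mul_finrank_le_sum_rank`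
(`ScottLemma.lean`).  "Applying the convolution with `λ⁻¹` to `(λ_r T_r, …, λ_1 T_1)` we get a
linearly rigid irreducible tuple in dimension `n' < n` by Corollary 3.6, Corollary 4.4 and
Lemma 2.7 (b)": irreducibility is `MiddleConvolution.isIrreducible_middleConvolution` (tree;
conditions `(∗)`, `(∗∗)` hold for irreducible tuples of rank `≥ 2`, [DettweilerReiter2000,
Remark 3.1] = `RigidTuple.condStar_of_isIrreducible`, `condStarStar_of_isIrreducible`), the rank is
the tree's rank formula `finrank_middleConvolution_add_finrank`, and Cor. 4.4 (the index of
rigidity is preserved) is assembled in `RigidTuple.reducesToRankOne_of_rigidityIndex_eq_two_aux`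
from the local identities `MiddleConvolution.centralizerDim_middleConvolution_local`
([DettweilerReiter2000, Lemma 4.1 (a)]) and `MiddleConvolution.middleConvolution_prodGenerators_eq_smul_one`
(the new `T_∞` is the scalar `λ⁻¹`, [DettweilerReiter2000, Lemma 4.1 (b), Remark 2.3]); a further
multiplication renormalises `T_∞ = 1`, and strong induction on `n` concludes.  We run the
induction on the invariant "index of rigidity `2`" rather than "linearly rigid", so Lemma 4.7 is
needed once, at the start, and only for the vendored hypothesis of Thm. 4.9.

Also proved: `RigidTuple.scalarMul_apply` (`M_Λ` is the twist by the character `f_i ↦ λ_i`),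
invariance of irreducibility and of the index under `M_Λ`, and the subrepresentation lemmas
`RigidTuple.eq_bot_or_eq_top_of_generators`, `RigidTuple.finrank_le_one_of_forall_eq_smul_one`.

## References
* M. Dettweiler, S. Reiter, *An algorithm of Katz and its application to the inverse Galois
  problem*, J. Symbolic Comput. 30 (2000) 761–798, Remark 3.1, Lemma 4.5, Lemma 4.7, Def. 4.8,
  Thm. 4.9 [DettweilerReiter2000].
* N. M. Katz, *Rigid Local Systems*, Annals of Math. Studies 139, 1996, Thm. 1.1.2, §5.2,
  Lemma 6.3.7 [Katz1996].
-/

noncomputable section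

namespace Literature.AlgebraicGeometry.Motives

open MiddleConvolution Module

universe u v


namespace RigidTuple

/-! ### Multiplication `M_Λ` ([DettweilerReiter2000, Def. 4.8]) -/

section ScalarMulLemmas

variable {K : Type*} [Field K] {V : Type*} [AddCommGroup V] [Module K V] {ι : Type*}

/-- `M_Λ(T)(g) = χ_Λ(g) · T(g)` with `χ_Λ : F → Kˣ` the character `f_i ↦ λ_i`: multiplication is
tensoring with the rank-one module `χ_Λ`. [cite: DettweilerReiter2000, Definition 4.8] -/
theorem scalarMul_apply (ρ : Representation K (FreeGroup ι) V) (Λ : ι → Kˣ) (g : FreeGroup ι) :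
    scalarMul ρ Λ g = ((FreeGroup.lift Λ g : Kˣ) : K) • ρ g := by
  induction g using FreeGroup.induction_on with
  | C1 => rw [map_one, map_one, map_one, Units.val_one, one_smul]
  | of i => rw [scalarMul_of, FreeGroup.lift_apply_of]
  | inv_of i _ =>
    -- both sides are the inverse of the unit `λ_i T_i`
    set a : (Module.End K V)ˣ :=
      ⟨scalarMul ρ Λ (FreeGroup.of i), scalarMul ρ Λ (FreeGroup.of i)⁻¹,
        by rw [← map_mul, mul_inv_cancel, map_one], by rw [← map_mul, inv_mul_cancel, map_one]⟩
      with ha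
    have h1 : scalarMul ρ Λ (FreeGroup.of i)⁻¹ = ((a⁻¹ : (Module.End K V)ˣ) : Module.End K V) := rfl
    have hmul : (a : Module.End K V) *
        ((((FreeGroup.lift Λ) (FreeGroup.of i)⁻¹ : Kˣ) : K) • ρ (FreeGroup.of i)⁻¹) = 1 := by
      show scalarMul ρ Λ (FreeGroup.of i) * _ = 1
      rw [scalarMul_of, map_inv, FreeGroup.lift_apply_of, smul_mul_smul_comm,
        Units.val_inv_eq_inv_val, mul_inv_cancel₀ (Units.ne_zero _), one_smul, ← map_mul,
        mul_inv_cancel, map_one]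
    rw [h1]
    exact Units.inv_eq_of_mul_eq_one_right hmul
  | mul x y hx hy => rw [map_mul, hx, hy, map_mul, map_mul, Units.val_mul, smul_mul_smul_comm]

/-- `M_Λ(T)_∞ = (Π_i λ_i) · T_∞`. [cite: DettweilerReiter2000, Definition 4.8] -/
theorem scalarMul_prodGenerators {r : ℕ} (ρ : Representation K (FreeGroup (Fin r)) V)
    (Λ : Fin r → Kˣ) :
    scalarMul ρ Λ (prodGenerators r) = ((∏ i, Λ i : Kˣ) : K) • ρ (prodGenerators r) := by
  rw [scalarMul_apply, prodGenerators, map_list_prod, List.map_ofFn, List.prod_ofFn]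
  simp only [Function.comp_def, FreeGroup.lift_apply_of]

/-- Multiplication does not change the lattice of submodules stable under the tuple; in
particular it preserves irreducibility. [cite: DettweilerReiter2000, Definition 4.8] -/
theorem isIrreducible_scalarMul (ρ : Representation K (FreeGroup ι) V) (Λ : ι → Kˣ)
    (h : ρ.IsIrreducible) : (scalarMul ρ Λ).IsIrreducible := by
  let e : Subrepresentation ρ ≃o Subrepresentation (scalarMul ρ Λ) :=
    { toFun := fun W => ⟨W.toSubmodule, fun g v hv => by
        rw [scalarMul_apply]
        exact W.toSubmodule.smul_mem _ (W.apply_mem_toSubmodule g hv)⟩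
      invFun := fun W => ⟨W.toSubmodule, fun g v hv => by
        have h1 := W.apply_mem_toSubmodule g hv
        rw [scalarMul_apply, LinearMap.smul_apply] at h1
        have h2 := W.toSubmodule.smul_mem (((FreeGroup.lift Λ g)⁻¹ : Kˣ) : K) h1
        rwa [smul_smul, Units.inv_mul, one_smul] at h2⟩
      left_inv := fun W => rfl
      right_inv := fun W => rfl
      map_rel_iff' := Iff.rfl }
  exact e.isSimpleOrder_iff.1 h

/-- Multiplication preserves the index of rigidity: `C(λ_i T_i) = C(T_i)` and
`C((Πλ_i) T_∞) = C(T_∞)`. [cite: DettweilerReiter2000, Definition 4.8] -/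
theorem rigidityIndex_scalarMul {r : ℕ} (ρ : Representation K (FreeGroup (Fin r)) V)
    (Λ : Fin r → Kˣ) : rigidityIndex (scalarMul ρ Λ) = rigidityIndex ρ := by
  unfold rigidityIndex centralizerDim
  rw [scalarMul_prodGenerators, centralizer_smul (Units.ne_zero _)]
  congr 2
  refine Finset.sum_congr rfl fun i _ => ?_
  rw [scalarMul_of, centralizer_smul (Units.ne_zero _)]

end ScalarMulLemmas

/-! ### Subrepresentations of a tuple, conditions `(∗)`, `(∗∗)` for irreducible tuples
([DettweilerReiter2000, Remark 3.1]) -/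

section Irreducible

variable {K : Type*} [Field K] {V : Type*} [AddCommGroup V] [Module K V] {ι : Type*}
variable (ρ : Representation K (FreeGroup ι) V)

/-- A subspace stable under the generators `T_i` of a finite-dimensional `F`-module is stable under
the whole free group (the inverses are handled by finite-dimensionality). [folklore] -/
theorem forall_apply_mem_of_generators [FiniteDimensional K V] (W : Submodule K V)
    (hW : ∀ i, ∀ v ∈ W, ρ (FreeGroup.of i) v ∈ W) (g : FreeGroup ι) : ∀ v ∈ W, ρ g v ∈ W := by
  induction g using FreeGroup.induction_on with
  | C1 => intro v hv; simpa using hv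
  | of i => exact hW i
  | inv_of i _ =>
    intro v hv
    have hli : Function.LeftInverse (ρ (FreeGroup.of i)⁻¹) (ρ (FreeGroup.of i)) := fun v => by
      rw [← Module.End.mul_apply, ← map_mul, inv_mul_cancel, map_one, Module.End.one_apply]
    have hmaple : W.map (ρ (FreeGroup.of i)) ≤ W :=
      Submodule.map_le_iff_le_comap.2 fun z hz => Submodule.mem_comap.2 (hW i z hz)
    have heq : W.map (ρ (FreeGroup.of i)) = W :=
      Submodule.eq_of_le_of_finrank_le hmaple
        (Submodule.equivMapOfInjective _ hli.injective W).finrank_eq.le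
    rw [← heq] at hv
    obtain ⟨w, hw, rfl⟩ := Submodule.mem_map.1 hv
    rw [hli w]
    exact hw
  | mul x y hx hy =>
    intro v hv
    rw [map_mul, Module.End.mul_apply]
    exact hx _ (hy _ hv)

/-- In an irreducible finite-dimensional tuple, a subspace stable under all `T_i` is `0` or `V`.
[folklore] -/
theorem eq_bot_or_eq_top_of_generators [FiniteDimensional K V] (hirr : ρ.IsIrreducible)
    (W : Submodule K V) (hW : ∀ i, ∀ v ∈ W, ρ (FreeGroup.of i) v ∈ W) : W = ⊥ ∨ W = ⊤ := by
  haveI : IsSimpleOrder (Subrepresentation ρ) := hirr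
  have hbot : (⊥ : Subrepresentation ρ).toSubmodule = ⊥ := rfl
  have htop : (⊤ : Subrepresentation ρ).toSubmodule = ⊤ := rfl
  rcases IsSimpleOrder.eq_bot_or_eq_top
    (⟨W, fun g v hv => forall_apply_mem_of_generators ρ W hW g v hv⟩ : Subrepresentation ρ) with h | h
  · exact Or.inl ((congrArg Subrepresentation.toSubmodule h).trans hbot)
  · exact Or.inr ((congrArg Subrepresentation.toSubmodule h).trans htop)

/-- An irreducible tuple all of whose elements are scalars has rank `≤ 1`
([DettweilerReiter2000, Remark 3.1]). [folklore] -/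
theorem finrank_le_one_of_forall_eq_smul_one [FiniteDimensional K V] (hirr : ρ.IsIrreducible)
    (h : ∀ i, ∃ c : K, ρ (FreeGroup.of i) = c • 1) : finrank K V ≤ 1 := by
  by_contra hV
  rw [not_le] at hV
  haveI : Nontrivial V := Module.nontrivial_of_finrank_pos (R := K) (M := V) (by omega)
  obtain ⟨v, hv⟩ := exists_ne (0 : V)
  have hW : ∀ i, ∀ w ∈ K ∙ v, ρ (FreeGroup.of i) w ∈ K ∙ v := by
    intro i w hw
    obtain ⟨c, hc⟩ := h i
    rw [hc, LinearMap.smul_apply, Module.End.one_apply]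
    exact Submodule.smul_mem _ c hw
  rcases eq_bot_or_eq_top_of_generators ρ hirr (K ∙ v) hW with h0 | h1
  · exact hv ((Submodule.span_singleton_eq_bot).1 h0)
  · have := finrank_span_singleton (K := K) hv
    rw [h1, finrank_top] at this
    omega

/-- **Condition `(∗)` holds for irreducible tuples of rank `≥ 2`** ([DettweilerReiter2000,
Remark 3.1]: "(∗) and (∗∗) are always fulfilled if `V` is irreducible and `dim V > 1`").
[cite: DettweilerReiter2000, Remark 3.1] -/
theorem condStar_of_isIrreducible [FiniteDimensional K V] (hirr : ρ.IsIrreducible)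
    (h2 : 2 ≤ finrank K V) : CondStar ρ := by
  intro i τ
  set X : Submodule K V := (⨅ j ∈ {j | j ≠ i}, LinearMap.ker (tuple ρ j - 1)) ⊓
    LinearMap.ker ((τ : K) • tuple ρ i - 1) with hX
  have hmem : ∀ v, v ∈ X ↔ (∀ j, j ≠ i → ρ (FreeGroup.of j) v = v) ∧ (τ : K) • ρ (FreeGroup.of i) v = v := by
    intro v
    simp only [hX, Submodule.mem_inf, Submodule.mem_iInf, LinearMap.mem_ker, LinearMap.sub_apply,
      Module.End.one_apply, sub_eq_zero, LinearMap.smul_apply, Set.mem_setOf_eq]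
  have hstab : ∀ k, ∀ v ∈ X, ρ (FreeGroup.of k) v ∈ X := by
    intro k v hv
    obtain ⟨hj, hi⟩ := (hmem v).1 hv
    rcases eq_or_ne k i with rfl | hk
    · have : ρ (FreeGroup.of k) v = ((τ⁻¹ : Kˣ) : K) • v := by
        conv_rhs => rw [← hi]
        rw [smul_smul, Units.inv_mul, one_smul]
      rw [this]
      exact X.smul_mem _ hv
    · rw [hj k hk]
      exact hv
  rcases eq_bot_or_eq_top_of_generators ρ hirr X hstab with h | h
  · exact h
  · exfalso
    have hsc : ∀ k, ∃ c : K, ρ (FreeGroup.of k) = c • 1 := by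
      intro k
      rcases eq_or_ne k i with rfl | hk
      · refine ⟨((τ⁻¹ : Kˣ) : K), LinearMap.ext fun v => ?_⟩
        have hv : v ∈ X := h ▸ Submodule.mem_top
        obtain ⟨_, hi⟩ := (hmem v).1 hv
        rw [LinearMap.smul_apply, Module.End.one_apply]
        conv_rhs => rw [← hi]
        rw [smul_smul, Units.inv_mul, one_smul]
      · refine ⟨1, LinearMap.ext fun v => ?_⟩
        have hv : v ∈ X := h ▸ Submodule.mem_top
        rw [one_smul, Module.End.one_apply]
        exact ((hmem v).1 hv).1 k hk
    have := finrank_le_one_of_forall_eq_smul_one ρ hirr hsc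
    omega

/-- **Condition `(∗∗)` holds for irreducible tuples of rank `≥ 2`** ([DettweilerReiter2000,
Remark 3.1]). [cite: DettweilerReiter2000, Remark 3.1] -/
theorem condStarStar_of_isIrreducible [FiniteDimensional K V] (hirr : ρ.IsIrreducible)
    (h2 : 2 ≤ finrank K V) : CondStarStar ρ := by
  intro i τ
  set Y : Submodule K V := (⨆ j ∈ {j | j ≠ i}, LinearMap.range (tuple ρ j - 1)) ⊔
    LinearMap.range ((τ : K) • tuple ρ i - 1) with hY
  have hYj : ∀ j, j ≠ i → ∀ v, ρ (FreeGroup.of j) v - v ∈ Y := by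
    intro j hj v
    refine Submodule.mem_sup_left ?_
    refine (Submodule.mem_iSup_of_mem j (Submodule.mem_iSup_of_mem hj ?_))
    exact ⟨v, rfl⟩
  have hYi : ∀ v, (τ : K) • ρ (FreeGroup.of i) v - v ∈ Y := fun v =>
    Submodule.mem_sup_right ⟨v, rfl⟩
  have hstab : ∀ k, ∀ v ∈ Y, ρ (FreeGroup.of k) v ∈ Y := by
    intro k v hv
    rcases eq_or_ne k i with rfl | hk
    · have : ρ (FreeGroup.of k) v =
          ((τ⁻¹ : Kˣ) : K) • (((τ : K) • ρ (FreeGroup.of k) v - v) + v) := by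
        rw [sub_add_cancel, smul_smul, Units.inv_mul, one_smul]
      rw [this]
      exact Y.smul_mem _ (Y.add_mem (hYi v) hv)
    · rw [← sub_add_cancel (ρ (FreeGroup.of k) v) v]
      exact Y.add_mem (hYj k hk v) hv
  rcases eq_bot_or_eq_top_of_generators ρ hirr Y hstab with h | h
  · exfalso
    have hsc : ∀ k, ∃ c : K, ρ (FreeGroup.of k) = c • 1 := by
      intro k
      rcases eq_or_ne k i with rfl | hk
      · refine ⟨((τ⁻¹ : Kˣ) : K), LinearMap.ext fun v => ?_⟩
        have hv : (τ : K) • ρ (FreeGroup.of k) v - v = 0 := by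
          rw [← Submodule.mem_bot K, ← h]
          exact hYi v
        have hv' : (τ : K) • ρ (FreeGroup.of k) v = v := sub_eq_zero.1 hv
        rw [LinearMap.smul_apply, Module.End.one_apply]
        conv_rhs => rw [← hv']
        rw [smul_smul, Units.inv_mul, one_smul]
      · refine ⟨1, LinearMap.ext fun v => ?_⟩
        have hv : ρ (FreeGroup.of k) v - v = 0 := by
          rw [← Submodule.mem_bot K, ← h]
          exact hYj k hk v
        rw [one_smul, Module.End.one_apply]
        exact sub_eq_zero.1 hv
    have := finrank_le_one_of_forall_eq_smul_one ρ hirr hsc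
    omega
  · exact h

end Irreducible

/-! ### Katz's algorithm: the reduction step ([DettweilerReiter2000, proof of Thm. 4.9]) -/

section KatzStep

variable {K : Type u} [Field K] {V : Type v} [AddCommGroup V] [Module K V]

/-- The elements `T_i = ρ(f_i)` of a tuple are invertible. [folklore] -/
theorem ker_apply_of_eq_bot {ι : Type*} (ρ : Representation K (FreeGroup ι) V) (i : ι) :
    LinearMap.ker (ρ (FreeGroup.of i)) = ⊥ := by
  have hli : Function.LeftInverse (ρ (FreeGroup.of i)⁻¹) (ρ (FreeGroup.of i)) := fun v => by
    rw [← Module.End.mul_apply, ← map_mul, inv_mul_cancel, map_one, Module.End.one_apply]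
  exact LinearMap.ker_eq_bot.2 hli.injective

/-- A commutant is never zero on a nonzero space (it contains the identity). [folklore] -/
theorem centralizerDim_pos [FiniteDimensional K V] [Nontrivial V] (X : Module.End K V) :
    0 < centralizerDim X := by
  unfold centralizerDim
  haveI : Nontrivial (Subalgebra.centralizer K ({X} : Set (Module.End K V))) :=
    ⟨⟨0, 1, fun h => zero_ne_one (congrArg Subtype.val h)⟩⟩
  exact Module.finrank_pos

variable [IsAlgClosed K] [FiniteDimensional K V]

/-- **The first half of the proof of [DettweilerReiter2000, Thm. 4.9]**: for an irreducible tuple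
`T` of rank `n ≥ 2` with `T_∞ = 1` and index of rigidity `2` over an algebraically closed field
there are `λ_i ∈ Kˣ` with `Σ_i rk(λ_i T_i − 1) < 2n` ("`n_i = min rk(λ_i T_i − 1)`,
`Σ dim C(T_i) = (r − 2)n² + 2 ≤ Σ (n/(n − n_i))(n − n_i)²`, so `Σ n_i < 2n`"), and then
`λ = λ_1 ⋯ λ_r ≠ 1` by Scott's lemma. [cite: DettweilerReiter2000, Theorem 4.9] -/
theorem exists_scalars_sum_rank_lt {r : ℕ} (ρ : Representation K (FreeGroup (Fin r)) V)
    (hirr : ρ.IsIrreducible) (h2 : 2 ≤ finrank K V) (h1 : ρ (prodGenerators r) = 1)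
    (hind : rigidityIndex ρ = 2) :
    ∃ Λ : Fin r → Kˣ,
      (∑ i, finrank K (LinearMap.range (tuple (scalarMul ρ Λ) i - 1))) < 2 * finrank K V ∧
        ((∏ i, Λ i : Kˣ) : K) ≠ 1 := by
  set n := finrank K V with hn
  have hpos : 0 < n := by omega
  haveI : Nontrivial V := Module.nontrivial_of_finrank_pos (R := K) (M := V) hpos
  -- choose `β_i` with `dim C(T_i) ≤ n · dim ker(T_i − β_i)`
  have hβ : ∀ i : Fin r, ∃ β : K, β ≠ 0 ∧ centralizerDim (ρ (FreeGroup.of i)) ≤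
      n * finrank K (LinearMap.ker (ρ (FreeGroup.of i) - β • 1)) := by
    intro i
    obtain ⟨β, hβ⟩ := exists_finrank_centralizer_le_mul n V rfl hpos (ρ (FreeGroup.of i))
    refine ⟨β, ?_, hβ⟩
    rintro rfl
    rw [zero_smul, sub_zero, ker_apply_of_eq_bot, finrank_bot, mul_zero] at hβ
    exact absurd (centralizerDim_pos (ρ (FreeGroup.of i))) (not_lt.2 hβ)
  choose β hβ0 hβle using hβ
  set Λ : Fin r → Kˣ := fun i => (Units.mk0 (β i) (hβ0 i))⁻¹ with hΛ
  have hrk : ∀ i, finrank K (LinearMap.range (tuple (scalarMul ρ Λ) i - 1)) =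
      finrank K (LinearMap.range (ρ (FreeGroup.of i) - β i • 1)) := by
    intro i
    have : tuple (scalarMul ρ Λ) i - 1 = (β i)⁻¹ • (ρ (FreeGroup.of i) - β i • 1) := by
      change scalarMul ρ Λ (FreeGroup.of i) - 1 = _
      rw [scalarMul_of, smul_sub, smul_smul, hΛ, Units.val_inv_eq_inv_val, Units.val_mk0,
        inv_mul_cancel₀ (hβ0 i), one_smul]
    rw [this, LinearMap.range_smul _ _ (inv_ne_zero (hβ0 i))]
  have hrn : ∀ i, finrank K (LinearMap.range (ρ (FreeGroup.of i) - β i • 1)) +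
      finrank K (LinearMap.ker (ρ (FreeGroup.of i) - β i • 1)) = n := fun i =>
    LinearMap.finrank_range_add_finrank_ker _
  -- `Σ dim C(T_i) = (r − 2) n² + 2`
  have hsum : (∑ i, (centralizerDim (ρ (FreeGroup.of i)) : ℤ)) = ((r : ℤ) - 2) * (n : ℤ) ^ 2 + 2 := by
    have := rigidityIndex_eq_of_prodGenerators_eq_one ρ h1
    rw [hind] at this
    linarith
  have hle : (∑ i, (centralizerDim (ρ (FreeGroup.of i)) : ℤ)) ≤
      (n : ℤ) * ∑ i, (finrank K (LinearMap.ker (ρ (FreeGroup.of i) - β i • 1)) : ℤ) := by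
    rw [Finset.mul_sum]
    exact Finset.sum_le_sum fun i _ => by exact_mod_cast hβle i
  have hk : ((r : ℤ) - 2) * n <
      ∑ i, (finrank K (LinearMap.ker (ρ (FreeGroup.of i) - β i • 1)) : ℤ) := by
    by_contra hc
    rw [not_lt] at hc
    have := mul_le_mul_of_nonneg_left hc (show (0 : ℤ) ≤ n by positivity)
    nlinarith
  have hT : (∑ i, (finrank K (LinearMap.range (ρ (FreeGroup.of i) - β i • 1)) : ℤ)) +
      ∑ i, (finrank K (LinearMap.ker (ρ (FreeGroup.of i) - β i • 1)) : ℤ) = r * n := by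
    rw [← Finset.sum_add_distrib]
    have : ∀ i ∈ (Finset.univ : Finset (Fin r)),
        (finrank K (LinearMap.range (ρ (FreeGroup.of i) - β i • 1)) : ℤ) +
          (finrank K (LinearMap.ker (ρ (FreeGroup.of i) - β i • 1)) : ℤ) = n := fun i _ => by
      exact_mod_cast hrn i
    rw [Finset.sum_congr rfl this, Finset.sum_const, Finset.card_univ, Fintype.card_fin,
      nsmul_eq_mul]
  have hlt : (∑ i, finrank K (LinearMap.range (tuple (scalarMul ρ Λ) i - 1))) < 2 * n := by
    simp_rw [hrk]
    have : (∑ i, (finrank K (LinearMap.range (ρ (FreeGroup.of i) - β i • 1)) : ℤ)) < 2 * n := by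
      linarith
    exact_mod_cast this
  refine ⟨Λ, hlt, fun hprod => ?_⟩
  -- Scott's lemma (`ScottLemma.lean`): if `Π λ_i = 1` then `(λ_i T_i)` has product `1`, so `Σ rk ≥ 2n`
  have h1' : (List.ofFn fun i => scalarMul ρ Λ (FreeGroup.of i)).prod = 1 := by
    have := scalarMul_prodGenerators ρ Λ
    rw [hprod, one_smul, h1, prodGenerators, map_list_prod, List.map_ofFn] at this
    simpa only [Function.comp_def] using this
  have hS := scott_two_mul_finrank_le_sum_rank (scalarMul ρ Λ) (isIrreducible_scalarMul ρ Λ hirr)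
    h2 h1'
  have hlt' : (∑ i, finrank K (LinearMap.range (scalarMul ρ Λ (FreeGroup.of i) - 1))) < 2 * n := hlt
  omega

end KatzStep

/-! ### Katz's algorithm for tuples of index of rigidity `2` ([DettweilerReiter2000, Thm. 4.9]) -/

section KatzAlgorithm

variable {K : Type u} [Field K] [IsAlgClosed K]

omit [IsAlgClosed K] in
/-- An irreducible module is nonzero. [folklore] -/
theorem finrank_pos_of_isIrreducible {V : Type v} [AddCommGroup V] [Module K V]
    [FiniteDimensional K V] {G : Type*} [Group G] (ρ : Representation K G V)
    (hirr : ρ.IsIrreducible) : 0 < finrank K V := by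
  haveI : IsSimpleOrder (Subrepresentation ρ) := hirr
  by_contra h0
  have hn0 : finrank K V = 0 := by omega
  haveI : Subsingleton V := Module.finrank_zero_iff.1 hn0
  haveI : Subsingleton (Submodule K V) := inferInstance
  exact IsSimpleOrder.bot_ne_top (α := Subrepresentation ρ)
    (Subrepresentation.toSubmodule_injective (Subsingleton.elim _ _))

/-- **Katz's existence algorithm for cohomologically rigid tuples** — the induction of
[DettweilerReiter2000, proof of Thm. 4.9] (= [Katz1996, §5.2, Lemma 6.3.7]) run on the invariant
"irreducible, `T_∞ = 1`, index of rigidity `2`": such a tuple of rank `n ≥ 2` becomes, after the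
multiplication `M_Λ` of `exists_scalars_sum_rank_lt` and the convolution `MC_{λ⁻¹}`, `λ = Πλ_i ≠ 1`,
an irreducible tuple (`MiddleConvolution.isIrreducible_middleConvolution`, [DettweilerReiter2000,
Cor. 3.6]) of rank `n' = Σ rk(λ_i T_i − 1) − n < n` (rank formula, [DettweilerReiter2000,
Lemma 2.7]) with `T'_∞ = λ⁻¹` (`MiddleConvolution.middleConvolution_prodGenerators_eq_smul_one`) and
the same index of rigidity ([DettweilerReiter2000, Cor. 4.4], here from
`MiddleConvolution.centralizerDim_middleConvolution_local`); one more multiplication makes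
`T'_∞ = 1`, and induction on `n` ends in rank one.  Auxiliary form, by strong induction on the
rank. [cite: DettweilerReiter2000, Theorem 4.9] -/
theorem reducesToRankOne_of_rigidityIndex_eq_two_aux (n : ℕ) :
    ∀ (W : Type v) [AddCommGroup W] [Module K W] [FiniteDimensional K W] (r : ℕ)
      (ρ : Representation K (FreeGroup (Fin r)) W), finrank K W = n → ρ.IsIrreducible →
        ρ (prodGenerators r) = 1 → rigidityIndex ρ = 2 → ReducesToRankOne K r W ρ := by
  induction n using Nat.strong_induction_on with
  | _ n ih =>
  intro W _ _ _ r ρ hn hirr h1 hind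
  have hpos : 0 < finrank K W := finrank_pos_of_isIrreducible ρ hirr
  by_cases hn2 : finrank K W < 2
  · exact ReducesToRankOne.rankOne ρ (by omega)
  rw [not_lt] at hn2
  -- `r = m + 1`
  obtain ⟨m, rfl⟩ : ∃ m, r = m + 1 := by
    rcases r with _ | m
    · exfalso
      have := finrank_le_one_of_forall_eq_smul_one ρ hirr (fun i => i.elim0)
      omega
    · exact ⟨m, rfl⟩
  obtain ⟨Λ, hlt, hne⟩ := exists_scalars_sum_rank_lt ρ hirr hn2 h1 hind
  have hirr' : (scalarMul ρ Λ).IsIrreducible := isIrreducible_scalarMul ρ Λ hirr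
  set μ : Kˣ := (∏ i, Λ i)⁻¹ with hμ
  have hμ1 : (μ : K) ≠ 1 := by
    intro h
    apply hne
    have hμ' : μ = 1 := Units.ext h
    rw [hμ, inv_eq_one] at hμ'
    rw [hμ', Units.val_one]
  have hμu : IsUnit ((μ : K) - 1) := (sub_ne_zero.2 hμ1).isUnit
  have hμprod : (μ : K) • scalarMul ρ Λ (prodGenerators (m + 1)) = 1 := by
    rw [scalarMul_prodGenerators, h1, smul_smul, hμ, Units.inv_mul, one_smul]
  have hstar : CondStar (scalarMul ρ Λ) := condStar_of_isIrreducible _ hirr' hn2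
  have hss : CondStarStar (scalarMul ρ Λ) := condStarStar_of_isIrreducible _ hirr' hn2
  -- the convolution `σ = MC_μ(M_Λ ρ)`
  have hirrσ : (middleConvolution (scalarMul ρ Λ) μ).IsIrreducible :=
    isIrreducible_middleConvolution _ μ hstar hirr'
  have hdim := finrank_middleConvolution_add_finrank (scalarMul ρ Λ) μ hμ1
  rw [hμprod, sub_self, LinearMap.range_zero, finrank_bot, add_zero] at hdim
  set n' := finrank K (Space (scalarMul ρ Λ) μ) with hn'
  have hn'lt : n' < n := by omega
  have hσprod : middleConvolution (scalarMul ρ Λ) μ (prodGenerators (m + 1)) = (μ : K) • 1 :=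
    middleConvolution_prodGenerators_eq_smul_one _ μ hμu hμprod
  -- the index of rigidity is preserved
  have hloc : ∀ i : Fin (m + 1),
      (centralizerDim (middleConvolution (scalarMul ρ Λ) μ (FreeGroup.of i)) : ℤ) =
        centralizerDim (ρ (FreeGroup.of i)) + ((n' : ℤ) ^ 2 - (finrank K W : ℤ) ^ 2) -
          2 * (finrank K (LinearMap.range (tuple (scalarMul ρ Λ) i - 1)) : ℤ) *
            ((n' : ℤ) - finrank K W) := by
    intro i
    obtain ⟨hrk, hcd⟩ :=
      centralizerDim_middleConvolution_local (scalarMul ρ Λ) μ i (hstar i μ) (hss i μ)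
    have e1 := LinearMap.finrank_range_add_finrank_ker
      (middleConvolution (scalarMul ρ Λ) μ (FreeGroup.of i) - 1)
    have e2 := LinearMap.finrank_range_add_finrank_ker (tuple (scalarMul ρ Λ) i - 1)
    rw [hrk] at e1
    have hb : centralizerDim (scalarMul ρ Λ (FreeGroup.of i)) = centralizerDim (ρ (FreeGroup.of i)) := by
      unfold centralizerDim
      rw [scalarMul_of, centralizer_smul (Units.ne_zero _)]
    have e1' : (finrank K (LinearMap.ker
        (middleConvolution (scalarMul ρ Λ) μ (FreeGroup.of i) - 1)) : ℤ) =
          n' - finrank K (LinearMap.range (tuple (scalarMul ρ Λ) i - 1)) := by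
      rw [hn']
      omega
    have e2' : (finrank K (LinearMap.ker (tuple (scalarMul ρ Λ) i - 1)) : ℤ) =
        finrank K W - finrank K (LinearMap.range (tuple (scalarMul ρ Λ) i - 1)) := by
      omega
    rw [e1', e2', hb] at hcd
    linear_combination hcd
  have hindσ : rigidityIndex (middleConvolution (scalarMul ρ Λ) μ) = 2 := by
    have hB : (∑ i, (centralizerDim (ρ (FreeGroup.of i)) : ℤ)) =
        2 + (((m + 1 : ℕ) : ℤ) - 2) * (finrank K W : ℤ) ^ 2 := by
      have := rigidityIndex_eq_of_prodGenerators_eq_one ρ h1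
      rw [hind] at this
      linarith
    have hT : (∑ i, (finrank K (LinearMap.range (tuple (scalarMul ρ Λ) i - 1)) : ℤ)) =
        n' + finrank K W := by
      rw [hn']
      exact_mod_cast hdim.symm
    have hinf : centralizerDim (middleConvolution (scalarMul ρ Λ) μ (prodGenerators (m + 1))) =
        n' ^ 2 := by
      rw [hσprod]
      unfold centralizerDim
      rw [centralizer_smul (Units.ne_zero μ)]
      exact centralizerDim_one
    unfold rigidityIndex
    rw [hinf, Finset.sum_congr rfl fun i _ => hloc i, Finset.sum_sub_distrib, Finset.sum_add_distrib,
      Finset.sum_const, Finset.card_univ, Fintype.card_fin, ← Finset.sum_mul, ← Finset.mul_sum, hB, hT]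
    push_cast
    ring
  -- renormalise `T'_∞ = μ` to `1` and apply the induction hypothesis
  set Λ' : Fin (m + 1) → Kˣ := Function.update 1 0 μ⁻¹ with hΛ'
  have hprodΛ' : (∏ i, Λ' i) = μ⁻¹ := by
    rw [hΛ', Finset.prod_update_of_mem (Finset.mem_univ _)]
    simp
  have h1₂ : scalarMul (middleConvolution (scalarMul ρ Λ) μ) Λ' (prodGenerators (m + 1)) = 1 := by
    rw [scalarMul_prodGenerators, hprodΛ', hσprod, smul_smul, Units.inv_mul, one_smul]
  have hirr₂ := isIrreducible_scalarMul _ Λ' hirrσ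
  have hind₂ : rigidityIndex (scalarMul (middleConvolution (scalarMul ρ Λ) μ) Λ') = 2 := by
    rw [rigidityIndex_scalarMul]
    exact hindσ
  have IH := ih n' hn'lt (Space (scalarMul ρ Λ) μ) (m + 1) _ rfl hirr₂ h1₂ hind₂
  exact ReducesToRankOne.mul ρ Λ
    (ReducesToRankOne.conv (scalarMul ρ Λ) μ hμ1 (ReducesToRankOne.mul _ Λ' IH))

/-- **Katz's existence algorithm from the numerical criterion** ([DettweilerReiter2000, Thm. 4.9
with Lemma 4.7]; [Katz1996, Thm. 5.2.1, Lemma 6.3.7]: irreducible cohomologically rigid local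
systems are built from rank one by middle convolutions and tensoring with rank-one systems):
over an algebraically closed field, an irreducible tuple `T` with `T_∞ = 1` and index of rigidity
`2` is connected to a rank-one tuple by multiplications `M_Λ` and convolutions `MC_λ` (`λ ≠ 1`),
i.e. `ReducesToRankOne`.  Unconditional form of
`DettweilerReiter2000_thm_4_9.of_rigidityIndex_eq_two`. [cite: DettweilerReiter2000, Theorem 4.9] -/
theorem reducesToRankOne_of_rigidityIndex_eq_two {V : Type v} [AddCommGroup V] [Module K V]
    [FiniteDimensional K V] {r : ℕ} (ρ : Representation K (FreeGroup (Fin r)) V)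
    (hirr : ρ.IsIrreducible) (h1 : ρ (prodGenerators r) = 1) (hind : rigidityIndex ρ = 2) :
    ReducesToRankOne K r V ρ :=
  reducesToRankOne_of_rigidityIndex_eq_two_aux (finrank K V) V r ρ rfl hirr h1 hind

end KatzAlgorithm


end RigidTuple

/-! ### The named facts of `RigidTuples.lean` -/

section NamedFacts

open RigidTuple

/-- **[DettweilerReiter2000, Thm. 4.9] follows from [DettweilerReiter2000, Lemma 4.7]** — exactly as
in the printed proof, whose first sentence invokes Lemma 4.7 ("Since `Σ dim C(T_i) = (r − 2)n² + 2`")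
and whose remainder is `RigidTuple.reducesToRankOne_of_rigidityIndex_eq_two`.  Lemma 4.7 (Katz's
[Katz1996, Thm. 1.1.2]; Strambach–Völklein in positive characteristic) is the named fact
`DettweilerReiter2000_lemma_4_7`; only its direction "linearly rigid ⟹ index of rigidity `2`" is
used. [cite: DettweilerReiter2000, Theorem 4.9] -/
theorem DettweilerReiter2000_thm_4_9_of_lemma_4_7 (h47 : DettweilerReiter2000_lemma_4_7.{u, v}) :
    DettweilerReiter2000_thm_4_9.{u, v} := by
  intro K _ _ V _ _ _ r ρ hirr h1 hrig
  exact reducesToRankOne_of_rigidityIndex_eq_two ρ hirr h1 ((h47 K V r ρ hirr h1).1 hrig)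

/-- **[DettweilerReiter2000, Thm. 4.9] from the remaining half of Lemma 4.7.**  With the tree's
`DettweilerReiter2000_lemma_4_7_iff_two_le` (`RigidTuplesProofs.lean`: the named fact Lemma 4.7 is
equivalent to "linearly rigid ⟹ index `≥ 2`", its other parts being proved there), Thm. 4.9 follows
from that single inequality ([Katz1996, Thm. 1.1.2 (1)]; [Haraoka2020, Thm. 7.8, third part]).
[cite: DettweilerReiter2000, Theorem 4.9] -/
theorem DettweilerReiter2000_thm_4_9_of_two_le
    (h : ∀ (K : Type u) [Field K] [IsAlgClosed K] (V : Type v) [AddCommGroup V] [Module K V]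
      [FiniteDimensional K V] (r : ℕ) (ρ : Representation K (FreeGroup (Fin r)) V),
      ρ.IsIrreducible → ρ (prodGenerators r) = 1 → IsLinearlyRigid ρ → 2 ≤ rigidityIndex ρ) :
    DettweilerReiter2000_thm_4_9.{u, v} :=
  DettweilerReiter2000_thm_4_9_of_lemma_4_7 (DettweilerReiter2000_lemma_4_7_iff_two_le.2 h)

end NamedFacts


end Literature.AlgebraicGeometry.Motives

end
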